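import Mathlib
import Summits.PneNP.PneNP.Theorems.LatticeMagicBooleanSosBlindAtConstantFactor

/-!
# PneNP / LatticeMagic — crux `Target`, RUNG LINE `SosSizeRung` (forward generator G1, seed g1-PneNP-2330)

**Floor (proved).** `Summit.PneNP.PneNP.Theses.LatticeMagic.BooleanSosBlindAtConstantFactor`
(item stmt-PneNP-2330), proved by `Summit.PneNP.PneNP.Theorems.ConA.booleanSosBlindAtConstantFactor_proof`:
static Boolean SOS of DEGREE `⌈n^δ⌉` (dual/KMOW form: a degree-`⌈n^δ⌉` Boolean pseudoexpectation
exists) does not refute the bit-encoded closeness system of poly-size NO-instances of `GapCVP_{γ₀}`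
(`γ₀ = 1`, `δ = 1/2`, Construction-A instances of unsatisfiable expanding 3-XOR systems).

**The rung (this file).** ONE move up the certificate ladder of the parent crux `Target`
(`GapCVP_c ∉ PromiseCoNP` = "NO sound proof system has poly-size certificates of farness"):
from the DEGREE measure to the Cook–Reckhow SIZE measure of the same proof system —
`SosSizeBlindAtConstantFactor`: every static Boolean SOS refutation
`Σ_i r_i² + t·Q + Σ_{v∈S} u_v·(X_v² − X_v) = −1` of the closeness equation `Q = closenessPoly p m = 0`
of suitable poly-size NO-instances `p` of `GapCVP_{γ₀}` has at least `2^{⌈n^δ⌉}` explicit monomials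
(Atserias–Hakoniemi liberal count `Σ_i |supp r_i| + |supp t|`). Equivalently: SOS, as a sound
refutation system for "far from the lattice at constant factor", is not polynomially bounded —
the first named instance of `Target`'s universally quantified claim.

**Graded family.** `Rung Blind` for a blindness notion `Blind : ℕ → MvPolynomial ℕ ℝ → Prop`;
`Rung DegreeBlind` is LITERALLY the floor (`rung_degreeBlind_iff`, `Iff.rfl`; witness `rung_special`),
`Rung SizeBlind` is the rung. Above it (prose only, LADDER): dynamic semialgebraic size (LS₊/PC_>),
CP, AC⁰-Frege, Frege, EF, all Cook–Reckhow systems (= `Target` ⟺ `NP ≠ coNP`, tree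
`Summit.PneNP.PneNP.Theorems.target_iff_NP_ne_coNP'`) → `PneNP` (landed `closes` of the route).

**Skeleton.** `stub_linearDegreeFewVars` (linear-degree fooling with `O(n)` variables and a
degree-2 equation — the landed ConA stubs at `r = ⌊κN⌋`), `stub_sizeDegreeTradeoff`
(Atserias–Hakoniemi 2019, Thm. 1 / Cor. 1 with `ℓ = 0`, `w = 1`, twin-free: arXiv:1811.01351),
`stub_weakDuality` (a degree-`d` pseudoexpectation kills every degree-`d` refutation; liberal
`u_v` via the Gröbner-basis remark, AH §2.2) and the sorry-free composition
`sosSizeBlindAtConstantFactor_of_pieces` (hypothesis form) / `SosSizeBlindAtConstantFactor_of`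
(closed form over the stubs; real arithmetic: `4√(2(An+2)(√n+1)) + 6 ≤ c·n` eventually).
-/

set_option linter.dupNamespace false

namespace Summit.PneNP.PneNP.Cruxes.Target.SosSizeRung

open scoped BigOperators
open Literature.Algebra.EuclideanLattices Literature.Computability.Complexity
  Literature.Computability.MetaComplexity Summit.PneNP.PneNP.Theorems.ConA

noncomputable section

/-! ## §1 The graded family and the rung -/

/-- Degree-`D` Boolean SOS blindness of the single equation `Q = 0` (KMOW dual form, tree
vocabulary `IsPseudoexpectation` / `SatisfiesIdentity` / `boolAxiom`): `ConA.Fooled` with the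
polynomial abstracted. (line vocabulary) -/
def DegreeBlind (D : ℕ) (Q : MvPolynomial ℕ ℝ) : Prop :=
  ∃ E : MvPolynomial ℕ ℝ →ₗ[ℝ] ℝ, IsPseudoexpectation D E ∧
    (∀ v : ℕ, SatisfiesIdentity D E (boolAxiom v)) ∧ SatisfiesIdentity D E Q

/-- A STATIC BOOLEAN SOS REFUTATION of the equation `Q = 0`: the formal polynomial identity
`Σ_i r_i² + t·Q + Σ_{v ∈ S} u_v·(X_v² − X_v) = −1` in `ℝ[X_0, X_1, …]`
(Atserias–Hakoniemi 2019, §2.2, with no inequality constraints, one equality constraint, twin-free).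
(line vocabulary) -/
def IsBoolSosRefutation (Q : MvPolynomial ℕ ℝ) (rs : List (MvPolynomial ℕ ℝ))
    (t : MvPolynomial ℕ ℝ) (S : Finset ℕ) (u : ℕ → MvPolynomial ℕ ℝ) : Prop :=
  (rs.map fun r => r * r).sum + t * Q + ∑ v ∈ S, u v * boolAxiom v = -1

/-- MONOMIAL SIZE of an explicit refutation `(r_1, …, r_k; t)`: `Σ_i |supp r_i| + |supp t|`
(Atserias–Hakoniemi 2019, §2.2 — the liberal convention: the Boolean-axiom multipliers `u_v` are
not counted, which only strengthens lower bounds). (line vocabulary) -/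
def refSize (rs : List (MvPolynomial ℕ ℝ)) (t : MvPolynomial ℕ ℝ) : ℕ :=
  (rs.map fun r => r.support.card).sum + t.support.card

/-- SIZE blindness at threshold `D`: every static Boolean SOS refutation of `Q = 0` has at least
`2^D` explicit monomials. (line vocabulary) -/
def SizeBlind (D : ℕ) (Q : MvPolynomial ℕ ℝ) : Prop :=
  ∀ (rs : List (MvPolynomial ℕ ℝ)) (t : MvPolynomial ℕ ℝ) (S : Finset ℕ)
    (u : ℕ → MvPolynomial ℕ ℝ), IsBoolSosRefutation Q rs t S u → 2 ^ D ≤ refSize rs t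

/-- THE GRADED FAMILY over the floor: "for some constant factor `γ₀ ≥ 1`, exponent `δ > 0` and
size exponent `C`, in infinitely many dimensions `n` some NO-instance `p` of `GapCVP_{γ₀}` of
bit-size `≤ n^C`, with bit budget `m ≤ n^C`, has its closeness equation `closenessPoly p m = 0`
`Blind` at threshold `⌈n^δ⌉`". `Rung DegreeBlind` = the floor verbatim; `Rung SizeBlind` = the rung.
(line vocabulary) -/
def Rung (Blind : ℕ → MvPolynomial ℕ ℝ → Prop) : Prop :=
  ∃ γ₀ : ℝ, 1 ≤ γ₀ ∧ ∃ δ : ℝ, 0 < δ ∧ ∃ C : ℕ, ∀ n₀ : ℕ, ∃ (p : GapCVPInstance) (m : ℕ),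
    n₀ ≤ p.1.I.n ∧ p ∈ GapCVP.no (fun _ => γ₀) ∧
    (GapCVPInstance.encode p).length ≤ p.1.I.n ^ C ∧ m ≤ p.1.I.n ^ C ∧
    Blind ⌈(p.1.I.n : ℝ) ^ δ⌉₊ (closenessPoly p m)

/-- **THE RUNG `SosSizeBlindAtConstantFactor`.** Static Boolean SOS, measured by MONOMIAL SIZE, is
blind to farness-from-the-lattice at a constant factor: for some `γ₀ ≥ 1`, `δ > 0`, `C`, in
infinitely many dimensions some poly-size NO-instance of `GapCVP_{γ₀}` has a closeness equation all
of whose static Boolean SOS refutations have `≥ 2^{⌈n^δ⌉}` explicit monomials. (the rung) -/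
def SosSizeBlindAtConstantFactor : Prop :=
  Rung SizeBlind

/-- The degree member of the family is LITERALLY the floor crux (definitional unfolding only). -/
theorem rung_degreeBlind_iff :
    Rung DegreeBlind ↔ Summit.PneNP.PneNP.Theses.LatticeMagic.BooleanSosBlindAtConstantFactor :=
  Iff.rfl

/-- **F3 WITNESS.** The rung family specialises to the PROVED floor: `Rung DegreeBlind` is the
theorem `booleanSosBlindAtConstantFactor_proof` (stmt-PneNP-2330, closed). -/
theorem rung_special : Rung DegreeBlind := by
  simpa only [rung_degreeBlind_iff] using booleanSosBlindAtConstantFactor_proof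

/-! ## §2 The skeleton: three stubs and the composition -/

/-- A refutation of EXPLICIT DEGREE `≤ d`: `2·deg r_i ≤ d` for every square, `deg t + deg Q ≤ d`
(the `u_v` unconstrained — liberal; Atserias–Hakoniemi's `deg s₀ ≤ d` implies `2 deg r_i ≤ d` over
`ℝ` by comparing top homogeneous components). (line vocabulary) -/
def IsDegRefutation (d : ℕ) (Q : MvPolynomial ℕ ℝ) (rs : List (MvPolynomial ℕ ℝ))
    (t : MvPolynomial ℕ ℝ) (S : Finset ℕ) (u : ℕ → MvPolynomial ℕ ℝ) : Prop :=
  IsBoolSosRefutation Q rs t S u ∧ (∀ r ∈ rs, 2 * r.totalDegree ≤ d) ∧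
    t.totalDegree + Q.totalDegree ≤ d

/-- The Atserias–Hakoniemi degree bound `⌊4·√(2(N+1)·ln s)⌋ + k + 4` for an equation of degree
`k = deg Q` in `N = |vars Q|` variables and a refutation of monomial size `s`
(arXiv:1811.01351, Thm. 1 with `w = 1`; natural logarithm). (line vocabulary) -/
def ahDegree (Q : MvPolynomial ℕ ℝ) (s : ℕ) : ℕ :=
  ⌊4 * Real.sqrt (2 * ((Q.vars.card : ℝ) + 1) * Real.log s)⌋₊ + Q.totalDegree + 4

/-- **STUB S1 `stub_linearDegreeFewVars` (size M).** Linear-degree fooling with few variables: for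
some `c > 0`, `A`, `C`, in infinitely many dimensions `n` a NO-instance `p` of `GapCVP_1` of bit-size
`≤ n^C` with a bit budget `m ≤ n^C` has a closeness polynomial with `≤ A·n` variables, of total
degree `≤ 2`, fooling degree-`⌈c·n⌉` Boolean SOS. Road: the landed ConA stubs `stub_fooled` (any
`D` with `3D + 3 ≤ Dx ≤ c r / 2`, `r = ⌊κ N⌋` LINEAR), `stub_no`, `stub_parity`, `stub_encode` with
`m = 2` (variables `X_(i,1), X_(i,2), X_(0,0), X_(1,0)`: `2n + 2` of them), exactly as in
`booleanSosBlindAtConstantFactor_proof` but keeping the linear degree; cf. the proved support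
`BooleanSosBlindAtEveryFactor` (stmt-PneNP-16059, degree `⌈(κ/100)·n⌉`).
[Grigoriev 2001; Schoenebeck 2008; Krajíček 2019 Thm. 16.3.3] -/
theorem stub_linearDegreeFewVars :
    ∃ c : ℝ, 0 < c ∧ ∃ A C : ℕ, ∀ n₀ : ℕ, ∃ (p : GapCVPInstance) (m : ℕ),
      n₀ ≤ p.1.I.n ∧ p ∈ GapCVP.no (fun _ => (1 : ℝ)) ∧
      (GapCVPInstance.encode p).length ≤ p.1.I.n ^ C ∧ m ≤ p.1.I.n ^ C ∧
      (closenessPoly p m).vars.card ≤ A * p.1.I.n ∧ (closenessPoly p m).totalDegree ≤ 2 ∧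
      DegreeBlind ⌈c * (p.1.I.n : ℝ)⌉₊ (closenessPoly p m) := by
  sorry

/-- **STUB S2 `stub_sizeDegreeTradeoff` (size XL — the NEW input; a printed theorem).**
Atserias–Hakoniemi size–degree trade-off for static SOS, equality-only, twin-free: a static Boolean
SOS refutation of `Q = 0` of monomial size `s ≥ 1` yields one of explicit degree
`≤ ⌊4√(2(|vars Q|+1)·ln s)⌋ + deg Q + 4`. Road: restrict the variables outside `vars Q` to `0`
(size and degree do not grow), embed into AH's twin-variable ring, apply Thm. 1 (`ℓ = 0`, `w = 1`;
duality modulo cut-off functions + unrestricting lemmas + random restrictions), substitute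
`x̄ ↦ 1 − x` back, and pass from `deg s₀ ≤ d` to `2 deg r_i ≤ d` by top homogeneous components.
[arXiv:1811.01351 Thm. 1, Cor. 1, §2.2; Lauria–Nordström CCC 2015 (Krajíček 2019 p. 343)] -/
theorem stub_sizeDegreeTradeoff (Q : MvPolynomial ℕ ℝ) (rs : List (MvPolynomial ℕ ℝ))
    (t : MvPolynomial ℕ ℝ) (S : Finset ℕ) (u : ℕ → MvPolynomial ℕ ℝ)
    (h : IsBoolSosRefutation Q rs t S u) (hs : 1 ≤ refSize rs t) :
    ∃ (rs' : List (MvPolynomial ℕ ℝ)) (t' : MvPolynomial ℕ ℝ) (S' : Finset ℕ)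
      (u' : ℕ → MvPolynomial ℕ ℝ), IsDegRefutation (ahDegree Q (refSize rs t)) Q rs' t' S' u' := by
  sorry

/-- **STUB S3 `stub_weakDuality` (size M).** Weak duality with liberal Boolean multipliers: a
degree-`d` Boolean pseudoexpectation satisfying `Q = 0` kills every refutation of explicit degree
`≤ d` — apply `E`: `E(r_i²) ≥ 0`, `E(Q t) = 0`, and `P := Σ u_v (X_v² − X_v) = −1 − Σ r_i² − tQ`
has degree `≤ d` and lies in the Boolean ideal, so (Gröbner basis `{X_v² − X_v}`; tree `ml`,
`ml_boolAxiom_mul`) `E P = 0` by reducing exponents one at a time inside degree `d`; but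
`E(−1) = −1`. [arXiv:1811.01351 §2.2 (Gröbner remark), Lemma 1; KMOW 2017 Def. 2.7–2.8] -/
theorem stub_weakDuality (d : ℕ) (Q : MvPolynomial ℕ ℝ) (hQ : DegreeBlind d Q)
    (rs : List (MvPolynomial ℕ ℝ)) (t : MvPolynomial ℕ ℝ) (S : Finset ℕ)
    (u : ℕ → MvPolynomial ℕ ℝ) : ¬ IsDegRefutation d Q rs t S u := by
  sorry

/-! ### Glue lemmas (proved) -/

/-- Explicit degree is monotone in the bound. -/
theorem isDegRefutation_mono {d d' : ℕ} (hd : d ≤ d') {Q : MvPolynomial ℕ ℝ}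
    {rs : List (MvPolynomial ℕ ℝ)} {t : MvPolynomial ℕ ℝ} {S : Finset ℕ}
    {u : ℕ → MvPolynomial ℕ ℝ} (h : IsDegRefutation d Q rs t S u) :
    IsDegRefutation d' Q rs t S u :=
  ⟨h.1, fun r hr => (h.2.1 r hr).trans hd, h.2.2.trans hd⟩

/-- A refutation of monomial size `0` has explicit degree `≤ d` as soon as `deg Q ≤ d`
(all `r_i` and `t` vanish). -/
theorem isDegRefutation_of_refSize_eq_zero {d : ℕ} {Q : MvPolynomial ℕ ℝ}
    {rs : List (MvPolynomial ℕ ℝ)} {t : MvPolynomial ℕ ℝ} {S : Finset ℕ}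
    {u : ℕ → MvPolynomial ℕ ℝ} (h : IsBoolSosRefutation Q rs t S u) (hs : refSize rs t = 0)
    (hQ : Q.totalDegree ≤ d) : IsDegRefutation d Q rs t S u := by
  unfold refSize at hs
  have hsum : (rs.map fun r => r.support.card).sum = 0 := by omega
  have ht : t.support.card = 0 := by omega
  refine ⟨h, fun r hr => ?_, ?_⟩
  · have hr0 : r.support.card = 0 := by
      rw [List.sum_eq_zero_iff] at hsum
      exact hsum _ (List.mem_map.2 ⟨r, hr, rfl⟩)
    have : r = 0 := MvPolynomial.support_eq_empty.1 (Finset.card_eq_zero.1 hr0)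
    simp [this]
  · have : t = 0 := MvPolynomial.support_eq_empty.1 (Finset.card_eq_zero.1 ht)
    simpa [this] using hQ

/-- The real-arithmetic heart of the composition: `4·√(2(V+1)·L) + 6 ≤ c·q²` once
`V + 1 ≤ B q²`, `0 ≤ L ≤ 2q`, `q ≥ 1` and `c² q ≥ 512 B + 12 c`. -/
theorem key_ineq {c B q L V : ℝ} (hc : 0 < c) (hB : 1 ≤ B) (hq : 1 ≤ q)
    (hq₀ : 512 * B + 12 * c ≤ c ^ 2 * q) (hL0 : 0 ≤ L) (hL : L ≤ 2 * q)
    (hV : V + 1 ≤ B * q ^ 2) : 4 * Real.sqrt (2 * (V + 1) * L) + 6 ≤ c * q ^ 2 := by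
  have hq0 : 0 ≤ q := by linarith
  have hB0 : 0 ≤ B := by linarith
  -- the radicand is at most `4 B q³`
  have hrad : 2 * (V + 1) * L ≤ 4 * B * q ^ 3 := by
    have h1 : 2 * (V + 1) * L ≤ 2 * (B * q ^ 2) * L :=
      mul_le_mul_of_nonneg_right (by linarith) hL0
    have h2 : 2 * (B * q ^ 2) * L ≤ 2 * (B * q ^ 2) * (2 * q) :=
      mul_le_mul_of_nonneg_left hL (by positivity)
    nlinarith
  -- `√(4 B q³) ≤ c q²/32 + 64 B q / c` by AM–GM
  set a : ℝ := c * q ^ 2 / 32 with ha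
  set b : ℝ := 64 * B * q / c with hb
  have hab : a * b = 2 * B * q ^ 3 := by
    rw [ha, hb]; field_simp; ring
  have ha0 : 0 ≤ a := by positivity
  have hb0 : 0 ≤ b := by positivity
  have hY : 4 * B * q ^ 3 ≤ (a + b) ^ 2 := by
    nlinarith [sq_nonneg (a - b), hab, mul_nonneg hB0 (pow_nonneg hq0 3)]
  have hsqrt : Real.sqrt (2 * (V + 1) * L) ≤ a + b := by
    rw [Real.sqrt_le_iff]
    exact ⟨by positivity, hrad.trans hY⟩
  -- `4 (a + b) + 6 ≤ c q²`
  have hfin : 4 * b + 6 ≤ 7 / 8 * c * q ^ 2 := by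
    have h1 : 256 * B * q + 6 * c ≤ 7 / 8 * c ^ 2 * q ^ 2 := by nlinarith
    have h2 : 4 * b + 6 = (256 * B * q + 6 * c) / c := by
      rw [hb]; field_simp; ring
    rw [h2, div_le_iff₀ hc]
    nlinarith
  have h4a : 4 * a = c * q ^ 2 / 8 := by rw [ha]; ring
  nlinarith

/-- **COMPOSITION (sorry-free).** The three stub STATEMENTS, as hypotheses, give the rung with
`γ₀ = 1`, `δ = 1/2`. -/
theorem sosSizeBlindAtConstantFactor_of_pieces
    (h1 : ∃ c : ℝ, 0 < c ∧ ∃ A C : ℕ, ∀ n₀ : ℕ, ∃ (p : GapCVPInstance) (m : ℕ),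
      n₀ ≤ p.1.I.n ∧ p ∈ GapCVP.no (fun _ => (1 : ℝ)) ∧
      (GapCVPInstance.encode p).length ≤ p.1.I.n ^ C ∧ m ≤ p.1.I.n ^ C ∧
      (closenessPoly p m).vars.card ≤ A * p.1.I.n ∧ (closenessPoly p m).totalDegree ≤ 2 ∧
      DegreeBlind ⌈c * (p.1.I.n : ℝ)⌉₊ (closenessPoly p m))
    (h2 : ∀ (Q : MvPolynomial ℕ ℝ) (rs : List (MvPolynomial ℕ ℝ)) (t : MvPolynomial ℕ ℝ)
      (S : Finset ℕ) (u : ℕ → MvPolynomial ℕ ℝ), IsBoolSosRefutation Q rs t S u →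
      1 ≤ refSize rs t → ∃ (rs' : List (MvPolynomial ℕ ℝ)) (t' : MvPolynomial ℕ ℝ)
        (S' : Finset ℕ) (u' : ℕ → MvPolynomial ℕ ℝ),
        IsDegRefutation (ahDegree Q (refSize rs t)) Q rs' t' S' u')
    (h3 : ∀ (d : ℕ) (Q : MvPolynomial ℕ ℝ), DegreeBlind d Q →
      ∀ (rs : List (MvPolynomial ℕ ℝ)) (t : MvPolynomial ℕ ℝ) (S : Finset ℕ)
        (u : ℕ → MvPolynomial ℕ ℝ), ¬ IsDegRefutation d Q rs t S u) :
    SosSizeBlindAtConstantFactor := by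
  classical
  obtain ⟨c, hc, A, C, hfam⟩ := h1
  -- constants of the threshold
  obtain ⟨B, hB⟩ : ∃ B : ℝ, B = (A : ℝ) + 1 := ⟨_, rfl⟩
  have hB1 : 1 ≤ B := by rw [hB]; have : (0 : ℝ) ≤ A := Nat.cast_nonneg A; linarith
  obtain ⟨T, hT⟩ : ∃ T : ℝ, T = (512 * B + 12 * c) / c ^ 2 := ⟨_, rfl⟩
  have hT0 : 0 ≤ T := by rw [hT]; positivity
  refine ⟨1, le_rfl, 1 / 2, by norm_num, C, fun n₀ => ?_⟩
  obtain ⟨p, m, hn₀, hno, hlen, hm, hvars, hdeg, hblind⟩ :=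
    hfam (n₀ + ⌈T ^ 2⌉₊ + ⌈2 / c⌉₊ + 2)
  refine ⟨p, m, by omega, hno, hlen, hm, ?_⟩
  -- the dimension as a real number `ν`, and `q = √ν`
  obtain ⟨n, hn⟩ : ∃ n : ℕ, n = p.1.I.n := ⟨_, rfl⟩
  rw [← hn] at hn₀ hvars hblind ⊢
  obtain ⟨ν, hν⟩ : ∃ ν : ℝ, ν = (n : ℝ) := ⟨_, rfl⟩
  have hνn : (n : ℝ) = ν := hν.symm
  have hν2 : (2 : ℝ) ≤ ν := by rw [hν]; exact_mod_cast (show 2 ≤ n by omega)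
  have hν1 : (1 : ℝ) ≤ ν := by linarith
  have hν0 : (0 : ℝ) ≤ ν := by linarith
  have hνT : T ^ 2 ≤ ν := by
    have h1 : (⌈T ^ 2⌉₊ : ℝ) ≤ ν := by rw [hν]; exact_mod_cast (show ⌈T ^ 2⌉₊ ≤ n by omega)
    exact (Nat.le_ceil _).trans h1
  have hνc : 2 / c ≤ ν := by
    have h1 : (⌈2 / c⌉₊ : ℝ) ≤ ν := by rw [hν]; exact_mod_cast (show ⌈2 / c⌉₊ ≤ n by omega)
    exact (Nat.le_ceil _).trans h1
  obtain ⟨q, hq⟩ : ∃ q : ℝ, q = Real.sqrt ν := ⟨_, rfl⟩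
  have hq0 : 0 ≤ q := by rw [hq]; exact Real.sqrt_nonneg ν
  have hqq : q ^ 2 = ν := by rw [hq]; exact Real.sq_sqrt hν0
  have hq1 : 1 ≤ q := by
    rw [hq, ← Real.sqrt_one]; exact Real.sqrt_le_sqrt hν1
  have hqT : T ≤ q := by
    rw [hq, ← Real.sqrt_sq hT0]; exact Real.sqrt_le_sqrt hνT
  have hq₀ : 512 * B + 12 * c ≤ c ^ 2 * q := by
    have h1 : c ^ 2 * T = 512 * B + 12 * c := by rw [hT]; field_simp
    have h2 : c ^ 2 * T ≤ c ^ 2 * q := mul_le_mul_of_nonneg_left hqT (by positivity)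
    linarith
  -- the degree of the fooling pseudoexpectation
  obtain ⟨d, hd⟩ : ∃ d : ℕ, d = ⌈c * (n : ℝ)⌉₊ := ⟨_, rfl⟩
  rw [← hd] at hblind
  have hcν : (d : ℝ) ≥ c * ν := by rw [hd, hνn]; exact Nat.le_ceil _
  have hd2 : 2 ≤ d := by
    have h1 : (2 : ℝ) ≤ c * ν := by
      have := mul_le_mul_of_nonneg_left hνc hc.le
      rwa [mul_div_cancel₀ _ hc.ne'] at this
    have h2 : (2 : ℝ) ≤ d := h1.trans hcν
    exact_mod_cast h2
  -- the size threshold `2^{⌈√ν⌉}`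
  rw [hνn, ← Real.sqrt_eq_rpow, ← hq]
  intro rs t S u href
  by_contra hlt
  rw [not_le] at hlt
  rcases Nat.eq_zero_or_pos (refSize rs t) with hs0 | hs1
  · -- a size-0 refutation is a degree-`d` refutation: contradiction with S3
    exact h3 d _ hblind rs t S u (isDegRefutation_of_refSize_eq_zero href hs0 (hdeg.trans hd2))
  · -- S2: a small refutation gives a low-degree one; S3: impossible below degree `d`
    obtain ⟨rs', t', S', u', href'⟩ := h2 _ rs t S u href hs1
    refine h3 d _ hblind rs' t' S' u' (isDegRefutation_mono ?_ href')
    -- the arithmetic: `ahDegree Q s ≤ d`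
    obtain ⟨s, hs⟩ : ∃ s : ℕ, s = refSize rs t := ⟨_, rfl⟩
    rw [← hs] at hlt hs1 ⊢
    have hs1r : (1 : ℝ) ≤ s := by exact_mod_cast hs1
    have hL0 : 0 ≤ Real.log s := Real.log_nonneg hs1r
    have hlog2 : Real.log 2 ≤ 1 := by
      have := Real.log_le_sub_one_of_pos (show (0 : ℝ) < 2 by norm_num)
      linarith
    have hL : Real.log s ≤ 2 * q := by
      have h1 : (s : ℝ) < (2 : ℝ) ^ ⌈q⌉₊ := by exact_mod_cast hlt
      have h2 : Real.log s < Real.log ((2 : ℝ) ^ ⌈q⌉₊) :=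
        Real.log_lt_log (by linarith) h1
      rw [Real.log_pow] at h2
      have h3 : (⌈q⌉₊ : ℝ) < q + 1 := Nat.ceil_lt_add_one hq0
      have h4 : (⌈q⌉₊ : ℝ) * Real.log 2 ≤ (q + 1) * 1 :=
        mul_le_mul h3.le hlog2 (Real.log_nonneg (by norm_num)) (by linarith)
      linarith
    have hV : ((closenessPoly p m).vars.card : ℝ) + 1 ≤ B * q ^ 2 := by
      rw [hqq, hB]
      have h1 : ((closenessPoly p m).vars.card : ℝ) ≤ A * ν := by
        rw [hν]; exact_mod_cast hvars
      nlinarith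
    have hkey := key_ineq hc hB1 hq1 hq₀ hL0 hL hV
    -- unfold `ahDegree` and compare in `ℝ`
    have hreal : ((ahDegree (closenessPoly p m) s : ℕ) : ℝ) ≤ d := by
      unfold ahDegree
      push_cast
      have hfl : (⌊4 * Real.sqrt (2 * (((closenessPoly p m).vars.card : ℝ) + 1) * Real.log s)⌋₊ : ℝ)
          ≤ 4 * Real.sqrt (2 * (((closenessPoly p m).vars.card : ℝ) + 1) * Real.log s) :=
        Nat.floor_le (by positivity)
      have hdg : (((closenessPoly p m).totalDegree : ℕ) : ℝ) ≤ 2 := by exact_mod_cast hdeg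
      rw [hqq] at hkey
      linarith
    exact_mod_cast hreal

/-- **The line closes the rung (modulo its stubs)**: `SosSizeBlindAtConstantFactor` BY NAME, from the
three registered stubs (this declaration contains no `sorry` of its own; cf. `KrajicekSplit.Target_of`). -/
theorem SosSizeBlindAtConstantFactor_of : SosSizeBlindAtConstantFactor :=
  sosSizeBlindAtConstantFactor_of_pieces stub_linearDegreeFewVars stub_sizeDegreeTradeoff
    stub_weakDuality

end

end Summit.PneNP.PneNP.Cruxes.Target.SosSizeRung
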